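import Summits.QuantumFields.YangMills.Theorems.BalabanUVNodesN19TargetAtHomes13CoPHOn
import Summits.QuantumFields.YangMills.Theorems.BalabanUVNodesN19VacuumMGFRoad

/-! v1.7 `CoPH` EDITION (FINDING №9∕LOCATED-9; director-ym №183 H1ʰ∕№186 (α)∕№190; def-T FILE 27 p537939 + 28T p539169; KEY-RULE-27 = KEYMAP v1.7 a6cf631b179f3b60; plan rev 24∕25;
dag-lead WORDS-143: K3⁷ = stmt-QuantumFields-20544) of my LANDED v1.6 module 24bᶜᵒᴾᴿ (p541241, STANDS): the SAME bytes under T₇ (`copr2coph_tokmap.py`: `CoPR ↦ CoPH`,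
`Stage13RParams ↦ Stage13HParams` (whole-history slots `Zh`∕`Phih`), `ZrUnity ↦ ZhUnity`, RR-2 guard `unityNondeg₁₃R ↦ unityNondeg₁₃H` (`Record13DatumKeyCoPH` p539151), not-re-issued letters at
`θ.toStage13Params` via the two-level `extends`; 4 thm, 0 def) over the v1.7 homes of record (dag-n27-c `…SpineCarriersOfRecord13CoPH`∕`…N27AtRecord13CoPHHome(On)`, dag-n22-e
`…RateCarriersOfRecord13CoPH(On)`, my 23ᶜᵒᴾᴴ p543022) consumed BY NAME.  Filed `--kind proof --supports stmt-QuantumFields-20544 --as helper`.  COUNT-NEUTRAL; every stub∕edge∕reading∕pin a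
HYPOTHESIS; NE7 NOT PRINTED∕proved; N19 0∕1.  Seat `pub-ymgap-dag-n19-d` g9, module 24bᶜᵒᴾᴴ.  Below: older headers under T₇ (edition names substituted; p-ids = ORIGINAL modules). -/
/-!
# BalabanUVNodes ∕ N19 (NE7 proper) — THE VACUUM-CORE ∕ MGF ∕ TILTED-MATCHING PRODUCER INTERFACE OF THE N19′ EDGE AT THE REGIME-RESTRICTED STAGE-13 TUPLES
# (lens «decomp» v4 road (ii) AT THE HOMES `SRec₁₃CoPHOn cr Rg` ∕ `RRec₁₃CoPHOn 𝔯 Rg`): module 24 §4's twin in the vacuum-MGF currency — the ₁₃ twin of module 15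
# (`…N19TargetAtHomes12OnVacuumMGF`, p482671), token for token with `12 ↦ 13`

Cell `pub-ymgap` (HUMAN RULING D-0062, Track A), R134 ACCELERATION seat `pub-ymgap-dag-n19-d` (strategy s2 «by-name knit at the record»), gen 7, module 24b.  Module 24
(`N19TargetAtHomes13CoPHOn`) §4 types the SOURCE-SPLIT producer interface of the same-tuple all-run-lengths edge that `BalabanUVNodesN27SpineRecord.forall_guarded₁₃CoPH_of_homes₁₃CoPHOn`
(dag-n27-c XXXIX) consumes: `towerEdge₁₃CoPHOn_of_sourceSplitReading` ∕ `towerEdge₁₃CoPHOn_of_insertionDerivReading` (dag-n19-e's (V)∕(I) currency).  The lens seat's v4 finding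
(`ym-lens-BalabanUVNodes-decomp/LENS-decomp.md` v4 f0080832305225a7; module 14 `N19VacuumMGFRoad` p480948, this seat, ROW VL) decomposes that currency BY NAME: (I) = node N14's residual
binder `DressedMGFForm.TiltedMeanMatching`, (V) = the N19 ledger road ON THE VACUUM CORES, the join `N19VacuumMGFRoad.coreEdge_of_coreZero_mgfForm`.  THIS MODULE instantiates the join at
the Stage-13 regime tuples of a spine reading `cr : SpineReading₁₃CoPH N` (RR-2's map §3: no ₁₂ ↔ ₁₃ bridge ⇒ module 15 re-typed; director-ym LINE №125 (3), №138):
* §1 `towerEdge₁₃CoPHOn_of_vacuumCoreMGFReading` — at every admissible θ with provisos IN THE REGIME, every `g₀`, `os`, given the rates at every run length of `𝔯`: `0 < vol`, the VACUUM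
  shell-free cores' `NE7.Core` with a summable `δ⁰`, MGF forms of both DRESSED shell-free cores (some field spaces, one bounded observable per run, class measures), and N14's
  `TiltedMeanMatching η` on those measures with `Summable η` ⇒ the edge `∃ δ, NE7.Core … (A − shA) (B − shB) δ ∧ Summable δ` at `cr F θ hP g₀ os` (one application of module 14).
* §2 `matchingUnder_guarded_datumOfRecord₁₃CoPH_of_homes₁₃CoPHOn_vacuumMGF` — module 24 §3 `matchingUnder_guarded_datumOfRecord₁₃CoPH_of_homes₁₃CoPHOn` with the edge PRODUCED by §1: the six K4
  stubs at `RRec₁₃CoPHOn 𝔯 Rg`, `S_N20` ∕ `S_N21` at `SRec₁₃CoPHOn cr Rg`, the guarded keyed extraction clause, and a vacuum-core ∕ MGF ∕ tilted-matching reading of `cr` ⇒ node U5's target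
  `MatchingUnder (datumOfRecord₁₃CoPH F N θ hP) END` at every admissible θ with provisos in the regime.
* §3 `towerEdge₁₃CoPHOn_of_vacuumLedgerPiecesMGFReading` ∕ `matchingUnder_guarded_datumOfRecord₁₃CoPH_of_homes₁₃CoPHOn_vacuumLedgerPiecesMGF` — the same with the vacuum `Core` itself PRODUCED
  by the ledger road at the pieces of record: F1 · F2 · F3 · S · C of `N19LedgerPieces` ON THE VACUUM CORES of `cr F θ hP g₀ os` + the SPECIES DATA in place of F3′ + the in-edge
  letters (module 14 §5 `coreEdge_of_vacuumLedgerPiecesSpecies_mgfForm`): what NODE O's vacuum instance of `LedgerDataSync` at the Stage-13 tuples must hand, BY NAME, with NO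
  observable and NO unprinted estimate inside N19.
At the guard of record `Rg := Node00.unityNondeg₁₃H N` and `N = 2` these are K3‴'s body up to its displayed antecedents (n27-c XXXVII); no Theses import here (rev 18 re-keys the id,
not the objects).  Filed `--kind proof --supports stmt-QuantumFields-19912 --as helper` (K3‴ `SpineGivenEndpointR13`).  COUNT-NEUTRAL.  THEOREMS ONLY; edits nothing.

HONEST FRAMING.  One-application compositions; the vacuum instance is a CHOICE OF INSTANCE for NODE O (lens v4), not a construction; the vacuum `Core`, the MGF forms, N14's
`TiltedMeanMatching`, every ledger piece ∕ species datum ∕ in-edge letter, every stub and the extraction clause are HYPOTHESES (0∕1); the readings `cr`, `𝔯` and the regime `Rg` are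
PARAMETERS; inhabitation of any regime class is K0‴ (open, HOLD №136∕138; nothing here reads `Provisos₁₃CoPH.bg`); nothing of Bałaban's is instantiated; NE7 ∕ NE3 ∕ NE1′ ∕ (2.43) NOT PRINTED
as two-run statements for d = 4 and NOT proved; NO node is discharged; K3‴ NOT claimed; counts UNMOVED (typed 28∕28 · discharged 5∕27, A 5∕28); one finite four-torus programme at fixed
`ε = L^{−K}` — NOT ℝ⁴, NOT infinite volume, NOT OS, NOT a mass gap, NOT Clay.  0 `def`; 0 `sorry`; standard axioms; no decl below carries a cite tag.
-/

set_option autoImplicit false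

noncomputable section

open Finset MeasureTheory

namespace Summit.QuantumFields.YangMills.BalabanUVNodes.N19TargetAtHomes13CoPHOnVacuumMGF

open Literature.MathematicalPhysics.QuantumFieldTheory.Balaban1983to89
open Literature.MathematicalPhysics.QuantumFieldTheory.Balaban1983to89.T4Continuum
open T4OutputRate (Carriers Functional LipBackground NE5 NE9)
open T4TowerRateComposition (PolyLipGrowth)
open T4CauchySum (InjectedRate)
open T4EtaRateMin (Readings NE3Shape)
open T4RateLiaison (GaugeDominated)
open T4ApexVariance (MatchingUnder)
open T4ContinuumYM4Torus (ForSmallCouplings)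
open Summit.QuantumFields.BalabanUV.T4Continuum.Spine
open Summit.QuantumFields.BalabanUV.T4Continuum.NE1p.DressedMGFForm (MGFForm TiltedMeanMatching)
open Summit.QuantumFields.YangMills.BalabanUVNodes.N19LedgerLinkSync (LedgerDataSync)
open Summit.QuantumFields.YangMills.BalabanUVNodes.N19LedgerPieces (TwoRunFormat LedgerBooking LedgerOtherKinds LedgerSize LedgerConventions)
open Summit.QuantumFields.YangMills.BalabanUVNodes.N19VacuumMGFRoad (coreEdge_of_coreZero_mgfForm coreEdge_of_vacuumLedgerPiecesSpecies_mgfForm)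
open Summit.QuantumFields.YangMills.BalabanUVNodes.N19TargetAtHomes13CoPHOn (matchingUnder_guarded_datumOfRecord₁₃CoPH_of_homes₁₃CoPHOn)
open YMDAG.UVSplit
open Node00 (Stage13HParams datumOfRecord₁₃CoPH)

variable {N : ℕ} [NeZero N] (cr : SpineReading₁₃CoPH N) (𝔯 : RateReading₁₃CoPH N) (Rg : (F : T4Family) → Stage13HParams F N → Prop)

/-! ## §1 The vacuum-core ∕ MGF ∕ tilted-matching reading on the regime PRODUCES XXVIII's edge -/

/-- **A VACUUM-CORE ∕ MGF ∕ TILTED-MATCHING READING ON THE REGIME PRODUCES THE EDGE** [bookkeeping] (module 14 `N19VacuumMGFRoad.coreEdge_of_coreZero_mgfForm` BY NAME at the Stage-13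
tuples): at every admissible θ with provisos IN THE REGIME, every `g₀`, `os`, given the rates at every run length of `𝔯`: `0 < vol`; the VACUUM shell-free cores
`(K, t, τ) ↦ A K 0 τ − shA K 0 τ`, `B K 0 τ − shB K 0 τ` carry `NE7.Core … δ⁰` with `Summable δ⁰` ((V): the N19 ledger road on the vacuum cores, or any N19 knit of record applied there);
MGF forms of both DRESSED shell-free cores; N14's `TiltedMeanMatching η` with `Summable η` ((I), N14's NE1′ residual by name) ⇒ the edge with `δ := δ⁰ + (l₀∕vol)·η`. -/
theorem towerEdge₁₃CoPHOn_of_vacuumCoreMGFReading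
    (hread : ∀ (F : T4Family) (θ : Stage13HParams F N) (hP : θ.Provisos₁₃CoPH F N), Rg F θ → θ.Admissible F N → ∀ (g₀ : ℕ → ℝ) (os : List (ULoop F)),
      (∀ k : ℕ, RatesAt (datumOfRecord₁₃CoPH F N θ hP) (rateCarriersOfRecord₁₃CoPH 𝔯 F θ hP g₀ os k)) → letI := (cr F θ hP g₀ os).dec
      0 < (cr F θ hP g₀ os).vol ∧
      ∃ (δ₀ η : ℕ → ℝ) (Ω Ω' : ℕ → Type) (_ : ∀ K, MeasurableSpace (Ω K)) (_ : ∀ K, MeasurableSpace (Ω' K)) (Bo : ℝ)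
        (Fo : ∀ K, Ω K → ℝ) (ν : ∀ K, (cr F θ hP g₀ os).ι → Measure (Ω K)) (Fo' : ∀ K, Ω' K → ℝ) (ν' : ∀ K, (cr F θ hP g₀ os).ι → Measure (Ω' K)),
        NE7.Core (cr F θ hP g₀ os).l₀ (cr F θ hP g₀ os).vol (cr F θ hP g₀ os).T (cr F θ hP g₀ os).Bad
          (fun K _ τ => (cr F θ hP g₀ os).A K 0 τ - (cr F θ hP g₀ os).shA K 0 τ) (fun K _ τ => (cr F θ hP g₀ os).B K 0 τ - (cr F θ hP g₀ os).shB K 0 τ) δ₀ ∧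
        Summable δ₀ ∧
        MGFForm Bo (cr F θ hP g₀ os).T Fo ν (fun K t τ => (cr F θ hP g₀ os).A K t τ - (cr F θ hP g₀ os).shA K t τ) ∧
        MGFForm Bo (cr F θ hP g₀ os).T Fo' ν' (fun K t τ => (cr F θ hP g₀ os).B K t τ - (cr F θ hP g₀ os).shB K t τ) ∧
        TiltedMeanMatching (cr F θ hP g₀ os).l₀ (cr F θ hP g₀ os).T (cr F θ hP g₀ os).Bad Fo ν Fo' ν' η ∧ Summable η)
    (F : T4Family) (θ : Stage13HParams F N) (hP : θ.Provisos₁₃CoPH F N) (hRg : Rg F θ) (hθ : θ.Admissible F N) (g₀ : ℕ → ℝ) (os : List (ULoop F))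
    (hall : ∀ k : ℕ, RatesAt (datumOfRecord₁₃CoPH F N θ hP) (rateCarriersOfRecord₁₃CoPH 𝔯 F θ hP g₀ os k)) : letI := (cr F θ hP g₀ os).dec
    ∃ δ : ℕ → ℝ, NE7.Core (cr F θ hP g₀ os).l₀ (cr F θ hP g₀ os).vol (cr F θ hP g₀ os).T (cr F θ hP g₀ os).Bad
      (fun K t τ => (cr F θ hP g₀ os).A K t τ - (cr F θ hP g₀ os).shA K t τ) (fun K t τ => (cr F θ hP g₀ os).B K t τ - (cr F θ hP g₀ os).shB K t τ) δ ∧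
      Summable δ := by
  letI := (cr F θ hP g₀ os).dec
  obtain ⟨hvol, δ₀, η, Ω, Ω', _, _, Bo, Fo, ν, Fo', ν', h0, hδ₀, hPm, hQm, hη, hηs⟩ := hread F θ hP hRg hθ g₀ os hall
  exact coreEdge_of_coreZero_mgfForm hvol hPm hQm h0 hδ₀ hη hηs

/-! ## §2 Node U5's DECL target on the regime from the stubs at the two regime homes and the vacuum-core ∕ MGF ∕ tilted-matching reading -/

/-- **NODE U5's DECL TARGET ON THE REGIME FROM THE STUBS AT THE TWO REGIME HOMES AND A VACUUM-CORE ∕ MGF ∕ TILTED-MATCHING READING** [bookkeeping] (module 24 §3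
`matchingUnder_guarded_datumOfRecord₁₃CoPH_of_homes₁₃CoPHOn` with the edge PRODUCED by §1): the six K4 stubs at `RRec₁₃CoPHOn 𝔯 Rg`, `S_N20` ∕ `S_N21` at `SRec₁₃CoPHOn cr Rg`, the guarded keyed
extraction clause, and the reading of §1 ⇒ `MatchingUnder (datumOfRecord₁₃CoPH F N θ hP) END` at every admissible θ with provisos IN THE REGIME.  Every input a HYPOTHESIS; on this road the
observable meets N19 only through N14's `η`. -/
theorem matchingUnder_guarded_datumOfRecord₁₃CoPH_of_homes₁₃CoPHOn_vacuumMGF (h14 : S_N14 (RRec₁₃CoPHOn 𝔯 Rg)) (h15 : S_N15 (RRec₁₃CoPHOn 𝔯 Rg))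
    (h16 : S_N16 (RRec₁₃CoPHOn 𝔯 Rg)) (h17 : S_N17 (RRec₁₃CoPHOn 𝔯 Rg)) (h18 : S_N18 (RRec₁₃CoPHOn 𝔯 Rg)) (h22 : S_N22 (RRec₁₃CoPHOn 𝔯 Rg)) (h20 : S_N20 (SRec₁₃CoPHOn cr Rg))
    (h21 : S_N21 (SRec₁₃CoPHOn cr Rg))
    (hx : ∀ (F : T4Family) (θ : Stage13HParams F N) (hP : θ.Provisos₁₃CoPH F N), Rg F θ → θ.Admissible F N →
      B16.EndStatementBPrinted (datumOfRecord₁₃CoPH F N θ hP).C → DagBinding.EndpointExistence (datumOfRecord₁₃CoPH F N θ hP).C.toB12 →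
        ForSmallCouplings (datumOfRecord₁₃CoPH F N θ hP) fun g₀ => ∀ os : List (ULoop F),
          0 < (cr F θ hP g₀ os).l₀ ∧ 0 < (cr F θ hP g₀ os).vol ∧
          (∀ (K : ℕ) (t : ℝ), |t| ≤ (cr F θ hP g₀ os).l₀ →
            T4GenFunBounds.schemeZ ((datumOfRecord₁₃CoPH F N θ hP).scheme g₀) os ((cr F θ hP g₀ os).K₀ + K) t =
              ∑ τ ∈ (cr F θ hP g₀ os).T K, (cr F θ hP g₀ os).A K t τ) ∧
          (∀ (K : ℕ) (t : ℝ), |t| ≤ (cr F θ hP g₀ os).l₀ →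
            T4GenFunBounds.schemeZ ((datumOfRecord₁₃CoPH F N θ hP).scheme g₀) os ((cr F θ hP g₀ os).K₀ + K + 1) t =
              ∑ τ ∈ (cr F θ hP g₀ os).T K, (cr F θ hP g₀ os).B K t τ))
    (hread : ∀ (F : T4Family) (θ : Stage13HParams F N) (hP : θ.Provisos₁₃CoPH F N), Rg F θ → θ.Admissible F N → ∀ (g₀ : ℕ → ℝ) (os : List (ULoop F)),
      (∀ k : ℕ, RatesAt (datumOfRecord₁₃CoPH F N θ hP) (rateCarriersOfRecord₁₃CoPH 𝔯 F θ hP g₀ os k)) → letI := (cr F θ hP g₀ os).dec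
      0 < (cr F θ hP g₀ os).vol ∧
      ∃ (δ₀ η : ℕ → ℝ) (Ω Ω' : ℕ → Type) (_ : ∀ K, MeasurableSpace (Ω K)) (_ : ∀ K, MeasurableSpace (Ω' K)) (Bo : ℝ)
        (Fo : ∀ K, Ω K → ℝ) (ν : ∀ K, (cr F θ hP g₀ os).ι → Measure (Ω K)) (Fo' : ∀ K, Ω' K → ℝ) (ν' : ∀ K, (cr F θ hP g₀ os).ι → Measure (Ω' K)),
        NE7.Core (cr F θ hP g₀ os).l₀ (cr F θ hP g₀ os).vol (cr F θ hP g₀ os).T (cr F θ hP g₀ os).Bad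
          (fun K _ τ => (cr F θ hP g₀ os).A K 0 τ - (cr F θ hP g₀ os).shA K 0 τ) (fun K _ τ => (cr F θ hP g₀ os).B K 0 τ - (cr F θ hP g₀ os).shB K 0 τ) δ₀ ∧
        Summable δ₀ ∧
        MGFForm Bo (cr F θ hP g₀ os).T Fo ν (fun K t τ => (cr F θ hP g₀ os).A K t τ - (cr F θ hP g₀ os).shA K t τ) ∧
        MGFForm Bo (cr F θ hP g₀ os).T Fo' ν' (fun K t τ => (cr F θ hP g₀ os).B K t τ - (cr F θ hP g₀ os).shB K t τ) ∧
        TiltedMeanMatching (cr F θ hP g₀ os).l₀ (cr F θ hP g₀ os).T (cr F θ hP g₀ os).Bad Fo ν Fo' ν' η ∧ Summable η)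
    (F : T4Family) (θ : Stage13HParams F N) (hP : θ.Provisos₁₃CoPH F N) (hRg : Rg F θ) (hθ : θ.Admissible F N) :
    MatchingUnder (datumOfRecord₁₃CoPH F N θ hP) (DagBinding.EndpointExistence (datumOfRecord₁₃CoPH F N θ hP).C.toB12) :=
  matchingUnder_guarded_datumOfRecord₁₃CoPH_of_homes₁₃CoPHOn cr 𝔯 Rg h14 h15 h16 h17 h18 h22 h20 h21 hx
    (towerEdge₁₃CoPHOn_of_vacuumCoreMGFReading cr 𝔯 Rg hread) F θ hP hRg hθ

/-! ## §3 The same with the vacuum `Core` PRODUCED by the ledger road at the pieces of record (NODE O's vacuum instance, by name) -/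

/-- **A VACUUM-LEDGER-PIECES ∕ SPECIES ∕ MGF ∕ TILTED-MATCHING READING ON THE REGIME PRODUCES THE EDGE** [bookkeeping] (module 14 §5
`N19VacuumMGFRoad.coreEdge_of_vacuumLedgerPiecesSpecies_mgfForm` BY NAME at the Stage-13 tuples): at every admissible θ with provisos IN THE REGIME, every `g₀`, `os`, given the rates at
every run length: `0 < vol`; ledger data `L`, readings `R` and letters with F1 `TwoRunFormat` · F2 `LedgerBooking` · F3 `LedgerOtherKinds` · S `LedgerSize` · C `LedgerConventions` ON THE
VACUUM shell-free cores of `cr F θ hP g₀ os`; the remaining kinds in SPECIES FORM with the ONE-RUN first-step bound and a constants' deviation datum; the in-edge letters (N16 `NE3Shape` +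
`GaugeDominated`, N18 `NE5`, N22 `NE9 ∧ FadingMemory`, N17∕U2 `InjectedRate`, box, (T) `LipBackground` + `PolyLipGrowth`, window); MGF forms of both dressed shell-free cores; N14's
`TiltedMeanMatching η`, `Summable η` ⇒ the edge.  NO observable kind, NO F3′ hypothesis. -/
theorem towerEdge₁₃CoPHOn_of_vacuumLedgerPiecesMGFReading
    (hread : ∀ (F : T4Family) (θ : Stage13HParams F N) (hP : θ.Provisos₁₃CoPH F N), Rg F θ → θ.Admissible F N → ∀ (g₀ : ℕ → ℝ) (os : List (ULoop F)),
      (∀ k : ℕ, RatesAt (datumOfRecord₁₃CoPH F N θ hP) (rateCarriersOfRecord₁₃CoPH 𝔯 F θ hP g₀ os k)) → letI := (cr F θ hP g₀ os).dec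
      0 < (cr F θ hP g₀ os).vol ∧
      ∃ (C : Carriers) (_ : DecidableEq C.Dom) (F' : Type) (ι' X' : Type) (_ : MeasurableSpace ι')
        (L : LedgerDataSync C F' ι' (cr F θ hP g₀ os).ι) (R : Readings ι' X') (W : Set (ℕ → ℝ)) (EA : Functional C C.BgA)
        (EB : Functional C C.BgB) (κ θ₅ C₅ C₉ ω θc Cd γ C₃ θ₃ Pg : ℝ) (q : ℕ) (Λm : ℕ → ℕ → ℝ)
        (CU : (ℕ → ℝ) → ℕ → ℝ) (g : ℕ → ℕ → ℝ) (uA : ℕ → ι' → C.BgA) (uB : ℕ → ι' → C.BgB)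
        (Φ : ℕ → ℝ → (cr F θ hP g₀ os).ι → ι' → ℝ) (e ρ : ℕ → ℝ) (α β : ℕ → ℝ → (cr F θ hP g₀ os).ι → ℝ)
        (η : ℕ → ℝ) (Ω Ω' : ℕ → Type) (_ : ∀ K, MeasurableSpace (Ω K)) (_ : ∀ K, MeasurableSpace (Ω' K)) (Bo : ℝ)
        (Fo : ∀ K, Ω K → ℝ) (ν : ∀ K, (cr F θ hP g₀ os).ι → Measure (Ω K)) (Fo' : ∀ K, Ω' K → ℝ) (ν' : ∀ K, (cr F θ hP g₀ os).ι → Measure (Ω' K)),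
        (TwoRunFormat L (cr F θ hP g₀ os).l₀ (cr F θ hP g₀ os).T (cr F θ hP g₀ os).Bad
            (fun K _ τ => (cr F θ hP g₀ os).A K 0 τ - (cr F θ hP g₀ os).shA K 0 τ) (fun K _ τ => (cr F θ hP g₀ os).B K 0 τ - (cr F θ hP g₀ os).shB K 0 τ) R EA EB g uA uB ∧
          LedgerBooking L (cr F θ hP g₀ os).l₀ (cr F θ hP g₀ os).vol (cr F θ hP g₀ os).T (cr F θ hP g₀ os).Bad κ ∧
          LedgerOtherKinds L (cr F θ hP g₀ os).l₀ (cr F θ hP g₀ os).vol (cr F θ hP g₀ os).T (cr F θ hP g₀ os).Bad R EA EB g ∧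
          LedgerSize L (cr F θ hP g₀ os).l₀ (cr F θ hP g₀ os).vol (cr F θ hP g₀ os).T (cr F θ hP g₀ os).Bad R EA EB g uA uB ∧
          LedgerConventions L (cr F θ hP g₀ os).vol R ω θc θ₅ θ₃) ∧
        ((∀ K t τ v, L.oA'' K t τ v = Real.exp (α K t τ)) ∧
          (∀ K t τ v, L.oB'' K t τ v = Real.exp (Φ K t τ v + e K) * Real.exp (β K t τ)) ∧
          (∀ K t τ, L.cO'' K t τ = e K + (β K t τ - α K t τ)) ∧ (∀ K t τ, L.RO'' K t τ = (cr F θ hP g₀ os).vol * ρ K) ∧ L.rO'' = ρ ∧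
          (∀ K t, |t| ≤ (cr F θ hP g₀ os).l₀ → ∀ τ ∈ (cr F θ hP g₀ os).T K \ (cr F θ hP g₀ os).Bad K t, ∀ v ∈ R.dom,
            |Φ K t τ v| ≤ (cr F θ hP g₀ os).vol * ρ K) ∧ Summable ρ ∧
          (∃ b₀ s : ℕ → ℝ, Summable s ∧ ∀ K t, |t| ≤ (cr F θ hP g₀ os).l₀ → ∀ τ ∈ (cr F θ hP g₀ os).T K \ (cr F θ hP g₀ os).Bad K t,
            |β K t τ - α K t τ - b₀ K| ≤ (cr F θ hP g₀ os).vol * s K)) ∧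
        (NE3Shape R C₃ θ₃ ∧ 0 ≤ C₃ ∧ GaugeDominated R uA uB ∧
          NE5 EA EB W κ θ₅ C₅ ∧ 0 ≤ θ₅ ∧ 0 ≤ C₅ ∧
          (NE9 EA W κ Λm ∧ T4OutputRate.FadingMemory C₉ ω Λm) ∧ 0 ≤ ω ∧
          InjectedRate Cd 0 θc (fun K j => T4CouplingMatching.disc (g K) (g (K + 1)) j) ∧ 0 ≤ Cd ∧ 0 ≤ θc ∧
          (∀ K i, i ≤ K → 0 < g K i ∧ g K i ≤ γ) ∧
          LipBackground EA W κ CU ∧ PolyLipGrowth CU g Pg q ∧ 0 ≤ Pg ∧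
          (∀ K, g K ∈ W) ∧ (∀ K, (fun i => g (K + 1) (i + 1)) ∈ W)) ∧
        (MGFForm Bo (cr F θ hP g₀ os).T Fo ν (fun K t τ => (cr F θ hP g₀ os).A K t τ - (cr F θ hP g₀ os).shA K t τ) ∧
          MGFForm Bo (cr F θ hP g₀ os).T Fo' ν' (fun K t τ => (cr F θ hP g₀ os).B K t τ - (cr F θ hP g₀ os).shB K t τ) ∧
          TiltedMeanMatching (cr F θ hP g₀ os).l₀ (cr F θ hP g₀ os).T (cr F θ hP g₀ os).Bad Fo ν Fo' ν' η ∧ Summable η))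
    (F : T4Family) (θ : Stage13HParams F N) (hP : θ.Provisos₁₃CoPH F N) (hRg : Rg F θ) (hθ : θ.Admissible F N) (g₀ : ℕ → ℝ) (os : List (ULoop F))
    (hall : ∀ k : ℕ, RatesAt (datumOfRecord₁₃CoPH F N θ hP) (rateCarriersOfRecord₁₃CoPH 𝔯 F θ hP g₀ os k)) : letI := (cr F θ hP g₀ os).dec
    ∃ δ : ℕ → ℝ, NE7.Core (cr F θ hP g₀ os).l₀ (cr F θ hP g₀ os).vol (cr F θ hP g₀ os).T (cr F θ hP g₀ os).Bad
      (fun K t τ => (cr F θ hP g₀ os).A K t τ - (cr F θ hP g₀ os).shA K t τ) (fun K t τ => (cr F θ hP g₀ os).B K t τ - (cr F θ hP g₀ os).shB K t τ) δ ∧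
      Summable δ := by
  letI := (cr F θ hP g₀ os).dec
  obtain ⟨hvol, C, _, F', ι', X', _, L, R, W, EA, EB, κ, θ₅, C₅, C₉, ω, θc, Cd, γ, C₃, θ₃, Pg, q, Λm, CU, g, uA, uB, Φ, e, ρ, α, β,
    η, Ω, Ω', _, _, Bo, Fo, ν, Fo', ν',
    ⟨hF, hB, hO, hSz, hC⟩, ⟨hoA, hoB, hcO, hRO, hrO, hΦ, hρ, hdev⟩,
    ⟨h16, hC₃, hgd, h18, hθ₅, hC₅, h22, hω, hinj, hCd, hθc, hbox, hU, hG, hPg, hgA, hgB⟩, hPm, hQm, hη, hηs⟩ :=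
    hread F θ hP hRg hθ g₀ os hall
  exact coreEdge_of_vacuumLedgerPiecesSpecies_mgfForm hF hB hO hSz hC hoA hoB hcO hRO hrO hΦ hρ hdev h16 hC₃ hgd h18 hθ₅ hC₅ h22 hω hinj hCd
    hθc hbox hU hG hPg hgA hgB hvol hPm hQm hη hηs

/-- **NODE U5's DECL TARGET ON THE REGIME FROM THE STUBS AT THE TWO REGIME HOMES AND NODE O's VACUUM LEDGER PIECES** [bookkeeping] (module 24 §3 with the edge PRODUCED by
`towerEdge₁₃CoPHOn_of_vacuumLedgerPiecesMGFReading`): the six K4 stubs at `RRec₁₃CoPHOn 𝔯 Rg`, `S_N20` ∕ `S_N21` at `SRec₁₃CoPHOn cr Rg`, the guarded keyed extraction clause, and — at every regime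
tuple, given the rates — the ledger pieces F1 · F2 · F3 · S · C on the VACUUM cores + species data + in-edge letters + MGF forms + N14's `η` ⇒ `MatchingUnder (datumOfRecord₁₃CoPH F N θ hP) END`
at every admissible θ with provisos IN THE REGIME.  THE road-(ii) ask at the Stage-13 homes with NO observable and NO unprinted estimate inside N19; every input a HYPOTHESIS. -/
theorem matchingUnder_guarded_datumOfRecord₁₃CoPH_of_homes₁₃CoPHOn_vacuumLedgerPiecesMGF (h14 : S_N14 (RRec₁₃CoPHOn 𝔯 Rg)) (h15 : S_N15 (RRec₁₃CoPHOn 𝔯 Rg))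
    (h16 : S_N16 (RRec₁₃CoPHOn 𝔯 Rg)) (h17 : S_N17 (RRec₁₃CoPHOn 𝔯 Rg)) (h18 : S_N18 (RRec₁₃CoPHOn 𝔯 Rg)) (h22 : S_N22 (RRec₁₃CoPHOn 𝔯 Rg)) (h20 : S_N20 (SRec₁₃CoPHOn cr Rg))
    (h21 : S_N21 (SRec₁₃CoPHOn cr Rg))
    (hx : ∀ (F : T4Family) (θ : Stage13HParams F N) (hP : θ.Provisos₁₃CoPH F N), Rg F θ → θ.Admissible F N →
      B16.EndStatementBPrinted (datumOfRecord₁₃CoPH F N θ hP).C → DagBinding.EndpointExistence (datumOfRecord₁₃CoPH F N θ hP).C.toB12 →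
        ForSmallCouplings (datumOfRecord₁₃CoPH F N θ hP) fun g₀ => ∀ os : List (ULoop F),
          0 < (cr F θ hP g₀ os).l₀ ∧ 0 < (cr F θ hP g₀ os).vol ∧
          (∀ (K : ℕ) (t : ℝ), |t| ≤ (cr F θ hP g₀ os).l₀ →
            T4GenFunBounds.schemeZ ((datumOfRecord₁₃CoPH F N θ hP).scheme g₀) os ((cr F θ hP g₀ os).K₀ + K) t =
              ∑ τ ∈ (cr F θ hP g₀ os).T K, (cr F θ hP g₀ os).A K t τ) ∧
          (∀ (K : ℕ) (t : ℝ), |t| ≤ (cr F θ hP g₀ os).l₀ →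
            T4GenFunBounds.schemeZ ((datumOfRecord₁₃CoPH F N θ hP).scheme g₀) os ((cr F θ hP g₀ os).K₀ + K + 1) t =
              ∑ τ ∈ (cr F θ hP g₀ os).T K, (cr F θ hP g₀ os).B K t τ))
    (hread : ∀ (F : T4Family) (θ : Stage13HParams F N) (hP : θ.Provisos₁₃CoPH F N), Rg F θ → θ.Admissible F N → ∀ (g₀ : ℕ → ℝ) (os : List (ULoop F)),
      (∀ k : ℕ, RatesAt (datumOfRecord₁₃CoPH F N θ hP) (rateCarriersOfRecord₁₃CoPH 𝔯 F θ hP g₀ os k)) → letI := (cr F θ hP g₀ os).dec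
      0 < (cr F θ hP g₀ os).vol ∧
      ∃ (C : Carriers) (_ : DecidableEq C.Dom) (F' : Type) (ι' X' : Type) (_ : MeasurableSpace ι')
        (L : LedgerDataSync C F' ι' (cr F θ hP g₀ os).ι) (R : Readings ι' X') (W : Set (ℕ → ℝ)) (EA : Functional C C.BgA)
        (EB : Functional C C.BgB) (κ θ₅ C₅ C₉ ω θc Cd γ C₃ θ₃ Pg : ℝ) (q : ℕ) (Λm : ℕ → ℕ → ℝ)
        (CU : (ℕ → ℝ) → ℕ → ℝ) (g : ℕ → ℕ → ℝ) (uA : ℕ → ι' → C.BgA) (uB : ℕ → ι' → C.BgB)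
        (Φ : ℕ → ℝ → (cr F θ hP g₀ os).ι → ι' → ℝ) (e ρ : ℕ → ℝ) (α β : ℕ → ℝ → (cr F θ hP g₀ os).ι → ℝ)
        (η : ℕ → ℝ) (Ω Ω' : ℕ → Type) (_ : ∀ K, MeasurableSpace (Ω K)) (_ : ∀ K, MeasurableSpace (Ω' K)) (Bo : ℝ)
        (Fo : ∀ K, Ω K → ℝ) (ν : ∀ K, (cr F θ hP g₀ os).ι → Measure (Ω K)) (Fo' : ∀ K, Ω' K → ℝ) (ν' : ∀ K, (cr F θ hP g₀ os).ι → Measure (Ω' K)),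
        (TwoRunFormat L (cr F θ hP g₀ os).l₀ (cr F θ hP g₀ os).T (cr F θ hP g₀ os).Bad
            (fun K _ τ => (cr F θ hP g₀ os).A K 0 τ - (cr F θ hP g₀ os).shA K 0 τ) (fun K _ τ => (cr F θ hP g₀ os).B K 0 τ - (cr F θ hP g₀ os).shB K 0 τ) R EA EB g uA uB ∧
          LedgerBooking L (cr F θ hP g₀ os).l₀ (cr F θ hP g₀ os).vol (cr F θ hP g₀ os).T (cr F θ hP g₀ os).Bad κ ∧
          LedgerOtherKinds L (cr F θ hP g₀ os).l₀ (cr F θ hP g₀ os).vol (cr F θ hP g₀ os).T (cr F θ hP g₀ os).Bad R EA EB g ∧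
          LedgerSize L (cr F θ hP g₀ os).l₀ (cr F θ hP g₀ os).vol (cr F θ hP g₀ os).T (cr F θ hP g₀ os).Bad R EA EB g uA uB ∧
          LedgerConventions L (cr F θ hP g₀ os).vol R ω θc θ₅ θ₃) ∧
        ((∀ K t τ v, L.oA'' K t τ v = Real.exp (α K t τ)) ∧
          (∀ K t τ v, L.oB'' K t τ v = Real.exp (Φ K t τ v + e K) * Real.exp (β K t τ)) ∧
          (∀ K t τ, L.cO'' K t τ = e K + (β K t τ - α K t τ)) ∧ (∀ K t τ, L.RO'' K t τ = (cr F θ hP g₀ os).vol * ρ K) ∧ L.rO'' = ρ ∧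
          (∀ K t, |t| ≤ (cr F θ hP g₀ os).l₀ → ∀ τ ∈ (cr F θ hP g₀ os).T K \ (cr F θ hP g₀ os).Bad K t, ∀ v ∈ R.dom,
            |Φ K t τ v| ≤ (cr F θ hP g₀ os).vol * ρ K) ∧ Summable ρ ∧
          (∃ b₀ s : ℕ → ℝ, Summable s ∧ ∀ K t, |t| ≤ (cr F θ hP g₀ os).l₀ → ∀ τ ∈ (cr F θ hP g₀ os).T K \ (cr F θ hP g₀ os).Bad K t,
            |β K t τ - α K t τ - b₀ K| ≤ (cr F θ hP g₀ os).vol * s K)) ∧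
        (NE3Shape R C₃ θ₃ ∧ 0 ≤ C₃ ∧ GaugeDominated R uA uB ∧
          NE5 EA EB W κ θ₅ C₅ ∧ 0 ≤ θ₅ ∧ 0 ≤ C₅ ∧
          (NE9 EA W κ Λm ∧ T4OutputRate.FadingMemory C₉ ω Λm) ∧ 0 ≤ ω ∧
          InjectedRate Cd 0 θc (fun K j => T4CouplingMatching.disc (g K) (g (K + 1)) j) ∧ 0 ≤ Cd ∧ 0 ≤ θc ∧
          (∀ K i, i ≤ K → 0 < g K i ∧ g K i ≤ γ) ∧
          LipBackground EA W κ CU ∧ PolyLipGrowth CU g Pg q ∧ 0 ≤ Pg ∧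
          (∀ K, g K ∈ W) ∧ (∀ K, (fun i => g (K + 1) (i + 1)) ∈ W)) ∧
        (MGFForm Bo (cr F θ hP g₀ os).T Fo ν (fun K t τ => (cr F θ hP g₀ os).A K t τ - (cr F θ hP g₀ os).shA K t τ) ∧
          MGFForm Bo (cr F θ hP g₀ os).T Fo' ν' (fun K t τ => (cr F θ hP g₀ os).B K t τ - (cr F θ hP g₀ os).shB K t τ) ∧
          TiltedMeanMatching (cr F θ hP g₀ os).l₀ (cr F θ hP g₀ os).T (cr F θ hP g₀ os).Bad Fo ν Fo' ν' η ∧ Summable η))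
    (F : T4Family) (θ : Stage13HParams F N) (hP : θ.Provisos₁₃CoPH F N) (hRg : Rg F θ) (hθ : θ.Admissible F N) :
    MatchingUnder (datumOfRecord₁₃CoPH F N θ hP) (DagBinding.EndpointExistence (datumOfRecord₁₃CoPH F N θ hP).C.toB12) :=
  matchingUnder_guarded_datumOfRecord₁₃CoPH_of_homes₁₃CoPHOn cr 𝔯 Rg h14 h15 h16 h17 h18 h22 h20 h21 hx
    (towerEdge₁₃CoPHOn_of_vacuumLedgerPiecesMGFReading cr 𝔯 Rg hread) F θ hP hRg hθ

end Summit.QuantumFields.YangMills.BalabanUVNodes.N19TargetAtHomes13CoPHOnVacuumMGF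

end
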